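import Literature.Claims.NS.Chae2007
import HarnessLib

/-!
# Claim skeleton C102 `Santak2026` — A. Šantak, «Extended Definitive Proof of Global Regularity and
# Absence of Finite-Time Singularities for the 3D Incompressible Navier-Stokes Equations via Dynamic
# Substrate Mechanics», Zenodo record 21607937 (2026-07-26; PDF dated «July 29, 2026»; = SSRN 7310168)

UNREFEREED CLAIM under adjudication (cell `ns-claims`, D-0090; row C102, T3 QUICK; typist
`ns-claims-typist-4` g5, refuter of record `ns-claims-refuter-6` g3, second `ns-claims-refuter-3` g3,
referee `ns-claims-ref-2` g6, salvage `ns-claims-salvage-p2` g4). **Nothing in this file asserts a step of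
the paper**: the claimed statement and every step are `Prop`-valued definitions; the theorems are the
kernel composition, the restriction bookkeeping, and the discharge of Step 1 (the Beale–Kato–Majda
dichotomy, a tree theorem). Bib key `Santak2026`; text of record = Zenodo record 21607937, 4 pp., PDF
page = printed page (`pub/ns-claims/sources/Santak2026/pages/p00N.txt`, LOCATORS.md by ns-claims-lit-1 g9,
sha16 0cb4ab3c8bb28ecf); line numbers below are those of the page text files.

## Claimed statement (verbatim, Theorem 5.1 p.4 l.2–17)

«Theorem 5.1 (Global Regularity and Boundedness). For any smooth initial data u0 ∈ C_c^∞(R³), the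
maximum vorticity norm X(t) satisfies: sup_{t∈[0,∞)} ‖ω(t)‖_{L∞} < ∞ (8) Consequently, the BKM integral
converges: ∫₀^∞ ‖ω(t)‖_{L∞} dt < ∞ (9) Thus, finite-time singularities are strictly prohibited, and a
unique global smooth solution exists for all time t ≥ 0.» Setting §1 p.2 l.2–15: (1) `∂ₜu + (u·∇)u =
−∇p + νΔu`, (2) `∇·u = 0` on `R³ × (0,∞)`, «smooth, divergence-free initial data u(x,0) = u0(x) ∈
C_c^∞(R³)», `ν > 0`; abstract p.1 l.17–18 «unconditional global regularity for any smooth initial data».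
Typed as `ClaimedTheorem`: for every `ν > 0` and every smooth divergence-free compactly supported datum,
a global classical solution in the Beale–Kato–Majda class (the class in which the paper quotes BKM, (3)
p.2) with (8) and (9). «Unique» is NOT typed (QUICK grain; no uniqueness class is printed) — flagged.

## Clay delta (reference `Literature.Claims.NS.ClayVariants`; facts LOCATORS §2)

Direction REGULARITY, nearest Clay statement (A) = `ClayVariants.clayR3.Regularity`. Δ1 = (ℝ³);
**Δ2 (equations): (1)–(2) are the Navier–Stokes equations, BUT the whole argument runs on the «modified
geometric framework» — the vorticity-dependent metric (4) p.3 and the enstrophy balance (5) p.3 carrying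
an ADDED operator `−D(ω)` «derived from the metric feedback»; (5) is typed AS PRINTED, as an assertion
about solutions of (1)–(2) (that is how §5/Theorem 5.1 use it); whether the locator sits on the modified
system (wrong problem, Δ2) or on the passage (1)–(2) ⇒ (5)–(6) is the refuter's call (RULINGS v1.33 (2))**;
Δ3 = (f ≡ 0); **Δ4: data `C_c^∞` ⊊ Clay's class (4) — the printed theorem covers FEWER data than (A), so
`ClaimedTheorem → clayR3.Regularity` is NOT provable as typed (no `clay_of_claimed`; recorded, not a
locator candidate by itself)**; Δ5 solution class: «smooth solution» rendered in the BKM class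
(`Chae2007.IsGlobalSolution` / `IsLocalSolution`: classical + all `L²` Sobolev norms bounded on compact
time intervals), no energy clause (7) printed; Δ6 = ([0,∞)); Δ7: `ν > 0` fixed arbitrary (=).

## The printed chain and the step index (print order = argument order of `claim_of_steps`)

Axiom 3.1 + Def 3.2 (4) p.3 → modified enstrophy equation (5) p.3 → Lemma 4.1 (6) p.3 → ODE inequality
(7) p.3 → Theorem 5.1 (8) ⇒ (9) ⇒ «unique global smooth solution» p.4, via BKM (3) p.2.

* Step 1 = `Step1_BKM` — (3) p.2 l.15–23, the Beale–Kato–Majda criterion as quoted («a singularity occurs if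
  and only if ∫₀^{T*}‖ω(t)‖_{L∞}dt = ∞») in the form the chain uses: from a `C_c^∞` datum, either a global
  solution in the BKM class or a solution on a maximal `[0,T*)` whose BKM integral diverges. TRUE —
  discharged in this file (`step1_holds`, the tree's `exists_global_bkmClass_or_blowup`).
* Axiom 3.1 p.3 l.2–3 («The physical domain Ω does not contain geometric points of exact zero volume …»)
  and Definition 3.2 (4) p.3 l.4–17 (the metric `g_{μν}(ω) = g⁰_{μν}(1 + |ω|²/(ω²_crit log(e+|ω|)))`) are
  not assertions about solutions of (1)–(2); they enter the chain only through the operator `D(ω)` of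
  (5) «derived from the metric feedback». The undefined printed symbols `D`, `c₀`, `C`, `Ψ₀`, `ω_crit`
  are carried by the parameter structure `Substrate` (pattern `N : Notions` of C07/C61); (4) is the
  definition `metricFactor`.
* Step 2 = `Step2_Balance5 N` — (5) p.3 l.21–38: along every solution of the class, the pointwise
  enstrophy balance WITH the extra term `−D(ω)`. TYPIST'S PREDICTED FIRST FAILING REGION ((5)/(6), CARD §4).
* Step 3 = `Step3_Lemma41 N` — Lemma 4.1 (6) p.3 l.39–55: `∫_{R³} D(ω) ≥ c₀‖ω‖³_∞/log(e+‖ω‖_∞)` for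
  every `ω ∈ H¹` (typed for smooth bounded `H¹` fields with `D(ω)` integrable — weaker, charitable).
* Step 4 = `Step4_ODE7 N` — (7) p.3 l.57–71: along every solution of the class, `X(t) = ‖ω(t)‖_∞` is finite,
  continuous, differentiable inside, and `dX/dt ≤ CX²(1 − log(e+X)/Ψ₀) − c₀X³/log(e+X)`. The print
  derives (7) from (5)–(6) («Incorporating … yields», l.57–60); the kernel composition consumes (7)
  itself, Steps 2–3 being consumed by that printed derivation (pattern of C14 `Lam2019`).
* Step 5 = `Step5_Barrier N` — proof of Theorem 5.1 p.4 l.18–21: «dX/dt ≤ 0 for all X ≥ X_max. Boundedness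
  of X(t) follows immediately via standard differential inequality arguments» — typed at the function
  grain: an `X_max` depending on the constants only, beyond which no solution of (7) can climb.
* Step 6 = `Step6_BKMIntegral` — (8) ⇒ (9) p.4 l.9–14 («Consequently, the BKM integral converges»), along
  global solutions of the class.

COMPOSITION: PROVED as `claim_of_steps` (Step 1 splits; in the blow-up branch Steps 4–5 bound `X` on
`[0,T*)`, so the BKM integral is finite — contradiction; in the global branch Steps 4–5 give (8) with the
`T`-independent bound `max(X(0), X_max)` and Step 6 gives (9)). Consumed by the kernel term: Steps 1, 4,
5, 6; Steps 2–3 are the printed support of Step 4 (named binders).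

WHAT THIS IS NOT: not a claim about NS regularity or blow-up; not a claim about any author beyond the
typed locator.
-/

open scoped ContDiff ENNReal NNReal Topology InnerProductSpace RealInnerProductSpace
open _root_.MeasureTheory _root_.Set _root_.Filter

namespace Literature.Claims.NS.Santak2026

open Literature.Analysis.FluidPDE

noncomputable section

/-! ## Vocabulary (definitions with bodies; nothing asserted) -/

/-- Physical space `ℝ³`. [cite: Santak2026, §1 (1)–(2) p.2] -/
abbrev E3 : Type := EuclideanSpace ℝ (Fin 3)

/-- The data class of §1 p.2 l.8–13 and Theorem 5.1 p.4 l.2–4: «smooth, divergence-free initial data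
u(x,0) = u0(x) ∈ C_c^∞(R³)» — the cell's BKM-class datum (`Chae2007.IsDatum`: smooth, divergence free,
every derivative in `L²`) of compact support (the `L²` clause is implied by compact support and is carried
only to reuse the cell's vocabulary). [cite: Santak2026, §1 p.2 l.8–13; Thm 5.1 p.4 l.2–4] -/
def IsDatum (u₀ : E3 → E3) : Prop :=
  Chae2007.IsDatum u₀ ∧ HasCompactSupport u₀

/-- `‖ω(t)‖_{L∞}` of a velocity slice `v`, `ω = ∇ × v` (p.2 l.23), in `[0,∞]` (no junk value; the real
number `X(t)` of §5 is its `toReal` where it is finite). [cite: Santak2026, (3) p.2; §5 p.3 l.57] -/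
def vortSup (v : E3 → E3) : ℝ≥0∞ := ⨆ x, ‖curl v x‖ₑ

/-- `X(t) = ‖ω(t)‖_{L∞}` (§5 p.3 l.57) as a real number along a velocity field `u`.
[cite: Santak2026, §5 p.3 l.57] -/
def X (u : ℝ → E3 → E3) (t : ℝ) : ℝ := (vortSup (u t)).toReal

/-- The undefined printed objects of §3–§5, carried as parameters (nothing about them is asserted here):
the «dissipation operator» `D(ω)` of (5)–(6) (a scalar field attached to a vorticity field; p.3 l.21–23
«derived from the metric feedback», no formula printed), the «universal constant c₀ > 0» of (6), the
constant `C` and the «spatial informational capacity bound» `Ψ₀` of (7) (p.3 l.70–71), and `ω_crit > 0`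
of (4). [cite: Santak2026, (4) p.3 l.4–17; (5)–(6) p.3 l.21–55; (7) p.3 l.57–71] -/
structure Substrate where
  /-- `D(ω)`: the added dissipation density of (5), as a function of the vorticity field. -/
  D : (E3 → E3) → E3 → ℝ
  /-- `c₀` of (6). -/
  c₀ : ℝ
  /-- `C` of (7). -/
  C : ℝ
  /-- `Ψ₀` of (7). -/
  Ψ₀ : ℝ
  /-- `ω_crit` of (4). -/
  ωcrit : ℝ
  /-- «for some universal constant c₀ > 0» (p.3 l.47). -/
  c₀_pos : 0 < c₀
  /-- `Ψ₀ > 0` (a «capacity bound», p.3 l.71; positivity is what (7) needs to be meaningful). -/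
  Ψ₀_pos : 0 < Ψ₀
  /-- «ω_crit > 0» (p.3 l.15). -/
  ωcrit_pos : 0 < ωcrit

/-- **Definition 3.2 (4) p.3**: the conformal factor `1 + |ω|²/(ω²_crit log(e+|ω|))` of the «dynamic metric
tensor» `g_{μν}(ω) = g⁰_{μν}·(…)`. Recorded as printed; it is not an assertion about (1)–(2) and no step
below depends on it except through `D`. [cite: Santak2026, Def 3.2 (4) p.3 l.4–17] -/
def metricFactor (N : Substrate) (w : E3) : ℝ :=
  1 + ‖w‖ ^ 2 / (N.ωcrit ^ 2 * Real.log (Real.exp 1 + ‖w‖))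

/-- The right-hand side of (7) p.3: `F(X) = CX²(1 − log(e+X)/Ψ₀) − c₀X³/log(e+X)`.
[cite: Santak2026, (7) p.3 l.61–69] -/
def rhs7 (N : Substrate) (x : ℝ) : ℝ :=
  N.C * x ^ 2 * (1 - Real.log (Real.exp 1 + x) / N.Ψ₀) - N.c₀ * x ^ 3 / Real.log (Real.exp 1 + x)

/-! ## The claimed statement -/

/-- **Theorem 5.1 p.4 l.2–17** (with §1 p.2 and the abstract p.1 l.17–18): for every `ν > 0` and every
smooth divergence-free datum `u₀ ∈ C_c^∞(ℝ³)` there is a global smooth solution — rendered in the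
Beale–Kato–Majda class in which the paper quotes its criterion (3) — with (8) `sup_{t≥0}‖ω(t)‖_∞ < ∞` and
(9) `∫₀^∞‖ω(t)‖_∞ dt < ∞`. «Unique» is not typed. [claim: Santak2026, status: disputed]
[cite: Santak2026, Thm 5.1 (8)–(9) p.4 l.2–17] -/
def ClaimedTheorem : Prop :=
  ∀ ν : ℝ, 0 < ν → ∀ u₀ : E3 → E3, IsDatum u₀ →
    ∃ (u : ℝ → E3 → E3) (p : ℝ → E3 → ℝ), Chae2007.IsGlobalSolution ν u₀ u p ∧
      (⨆ t ∈ Ici (0 : ℝ), vortSup (u t)) < ⊤ ∧ (∫⁻ t in Ioi (0 : ℝ), vortSup (u t)) < ⊤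

/-! ## The steps -/

/-- **Step 1 — the Beale–Kato–Majda criterion (3) p.2 l.15–23** («a singularity occurs if and only if the
time integral of the maximum vorticity diverges: ∫₀^{T*}‖ω(t)‖_{L∞}dt = ∞»), in the form the chain uses it
(Theorem 5.1: (9)/(8) ⇒ «finite-time singularities are strictly prohibited»): from every datum of the
class, EITHER a global solution in the BKM class exists, OR there are `T* > 0` and a solution on `[0,T*)`
in the class whose BKM integral `∫₀^{T*} sup_x|ω|` diverges. TRUE: `step1_holds` below (Beale–Kato–Majda
1984 / Majda–Bertozzi 2002 Thm 3.6, PROVED in the tree). [claim: Santak2026, status: disputed]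
[cite: Santak2026, (3) p.2 l.15–23] [cite: BealeKatoMajda1984, Thm. 1 and Corollary] -/
def Step1_BKM : Prop :=
  ∀ ν : ℝ, 0 < ν → ∀ u₀ : E3 → E3, IsDatum u₀ →
    (∃ (u : ℝ → E3 → E3) (p : ℝ → E3 → ℝ), Chae2007.IsGlobalSolution ν u₀ u p) ∨
    ∃ Ts : ℝ, 0 < Ts ∧ ∃ (u : ℝ → E3 → E3) (p : ℝ → E3 → ℝ),
      Chae2007.IsLocalSolution ν Ts u₀ u p ∧ (∫⁻ t in Ioo 0 Ts, vortSup (u t)) = ⊤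

/-- **Step 2 — the modified enstrophy equation (5) p.3 l.21–38**: «The enstrophy evolution equation under
the modified geometric framework incorporates an active dissipation operator D(ω) derived from the
metric feedback: ∂ₜ(½|ω|²) + u·∇(½|ω|²) = (ω·∇)u·ω − ν|∇ω|² − D(ω) (5)» — typed AS PRINTED, pointwise
on `[0,T) × ℝ³`, along every solution of the class from a datum of the class (the print's standing
setting §1), `ω = curl u`, `(ω·∇)u = Du[ω]`, `|∇ω|²` the Frobenius square of `Dω`, `∂ₜ` one-sided within
`[0,T)`. (For comparison, NOT typed: for solutions of (1)–(2) the pointwise balance obtained by dotting the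
vorticity equation with `ω` reads `∂ₜ(½|ω|²) + u·∇(½|ω|²) = (ω·∇)u·ω + ν ω·Δω`, LOCATORS §3.)
[claim: Santak2026, status: disputed] [cite: Santak2026, (5) p.3 l.21–38] -/
def Step2_Balance5 (N : Substrate) : Prop :=
  ∀ ν : ℝ, 0 < ν → ∀ (T : ℝ) (u₀ : E3 → E3) (u : ℝ → E3 → E3) (p : ℝ → E3 → ℝ), IsDatum u₀ →
    Chae2007.IsLocalSolution ν T u₀ u p → ∀ t ∈ Ico 0 T, ∀ x : E3,
      timeDerivWithin (Ico 0 T) (fun s y => (1 / 2 : ℝ) * ‖curl (u s) y‖ ^ 2) t x +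
          fderiv ℝ (fun y => (1 / 2 : ℝ) * ‖curl (u t) y‖ ^ 2) x (u t x) =
        ⟪fderiv ℝ (u t) x (curl (u t) x), curl (u t) x⟫ -
          ν * frobeniusNormSq (fderiv ℝ (curl (u t)) x) - N.D (curl (u t)) x

/-- **Step 3 — Lemma 4.1 (Coercivity of Geometric Dissipation) (6) p.3 l.39–55**: «For any ω ∈ H¹(R³), the
dissipation operator satisfies the lower bound: ∫_{R³} D(ω)dx ≥ c₀‖ω‖³_{L∞}/log(e + ‖ω‖_{L∞}) (6) for some
universal constant c₀ > 0.» (printed proof, one sentence: «Integration of the dynamic metric feedback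
across the domain R³ yields a lower bound scaling as cubic vorticity divided by its logarithmic envelope
…»). Typed, charitably, for SMOOTH `H¹` fields with bounded modulus and `D(ω)` integrable (so both sides
are genuine numbers); `‖ω‖_∞` is the supremum of `|ω|`. [claim: Santak2026, status: disputed]
[cite: Santak2026, Lemma 4.1 (6) p.3 l.39–55] -/
def Step3_Lemma41 (N : Substrate) : Prop :=
  ∀ w : E3 → E3, ContDiff ℝ ∞ w → (∫⁻ x, ‖w x‖ₑ ^ 2) < ⊤ → (∫⁻ x, ‖fderiv ℝ w x‖ₑ ^ 2) < ⊤ →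
    BddAbove (Set.range fun x => ‖w x‖) → Integrable (N.D w) →
      N.c₀ * (⨆ x, ‖w x‖) ^ 3 / Real.log (Real.exp 1 + ⨆ x, ‖w x‖) ≤ ∫ x, N.D w x

/-- **Step 4 — the differential inequality (7) p.3 l.57–71**: «Let X(t) = ‖ω(t)‖_{L∞}. Incorporating the
dynamic metric feedback and coercive enstrophy dissipation yields the rigorous differential inequality:
dX/dt ≤ CX²(1 − log(e+X)/Ψ₀) − c₀X³/log(e+X) (7)». Typed along every solution of the class: `‖ω(t)‖_∞` is
finite on `[0,T)` (implicit in «Let X(t) = …» and in differentiating it), `X` is continuous on `[0,T)`,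
differentiable on `(0,T)`, and satisfies (7) there. The printed derivation of (7) from (5)–(6) is the
«yields» of l.57–60 (Steps 2–3 are its support; the kernel composition consumes (7) itself).
[claim: Santak2026, status: disputed] [cite: Santak2026, (7) p.3 l.57–71] -/
def Step4_ODE7 (N : Substrate) : Prop :=
  ∀ ν : ℝ, 0 < ν → ∀ (T : ℝ) (u₀ : E3 → E3) (u : ℝ → E3 → E3) (p : ℝ → E3 → ℝ), IsDatum u₀ →
    Chae2007.IsLocalSolution ν T u₀ u p →
      (∀ t ∈ Ico 0 T, vortSup (u t) < ⊤) ∧ ContinuousOn (X u) (Ico 0 T) ∧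
        ∀ t ∈ Ioo 0 T, DifferentiableAt ℝ (X u) t ∧ deriv (X u) t ≤ rhs7 N (X u t)

/-- **Step 5 — proof of Theorem 5.1 p.4 l.18–21**: «As X(t) → ∞, the negative dissipation term strictly
dominates the nonlinear stretching terms, forcing dX/dt ≤ 0 for all X ≥ X_max. Boundedness of X(t)
follows immediately via standard differential inequality arguments». Typed at the function grain: there
is `X_max`, depending on the constants of (7) only, such that every continuous `X` on `[0,T)`,
differentiable on `(0,T)` with `X′ ≤ F(X)` there, obeys `X(t) ≤ max(X(0), X_max)` on `[0,T)`. (Classical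
barrier argument; typist's flag: true as typed.) [claim: Santak2026, status: disputed]
[cite: Santak2026, Thm 5.1 proof p.4 l.18–21] -/
def Step5_Barrier (N : Substrate) : Prop :=
  ∃ Xmax : ℝ, ∀ (Y : ℝ → ℝ) (T : ℝ), ContinuousOn Y (Ico 0 T) →
    (∀ t ∈ Ioo 0 T, DifferentiableAt ℝ Y t ∧ deriv Y t ≤ rhs7 N (Y t)) →
      ∀ t ∈ Ico 0 T, Y t ≤ max (Y 0) Xmax

/-- **Step 6 — (8) ⇒ (9), Theorem 5.1 p.4 l.9–14** («Consequently, the BKM integral converges: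
∫₀^∞‖ω(t)‖_{L∞}dt < ∞ (9)»): along every global solution of the class from a datum of the class, a bounded
`‖ω(t)‖_∞` on `[0,∞)` has a finite time integral over `(0,∞)`. (No argument is printed; at the function
grain a bounded function need not be integrable on `(0,∞)` — typed at the solution grain, as printed.)
[claim: Santak2026, status: disputed] [cite: Santak2026, Thm 5.1 (8)–(9) p.4 l.9–14] -/
def Step6_BKMIntegral : Prop :=
  ∀ ν : ℝ, 0 < ν → ∀ (u₀ : E3 → E3) (u : ℝ → E3 → E3) (p : ℝ → E3 → ℝ), IsDatum u₀ →
    Chae2007.IsGlobalSolution ν u₀ u p → (⨆ t ∈ Ici (0 : ℝ), vortSup (u t)) < ⊤ →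
      (∫⁻ t in Ioi (0 : ℝ), vortSup (u t)) < ⊤

/-! ## Step 1 is a tree theorem -/

/-- **Step 1 holds**: the Beale–Kato–Majda dichotomy for `H^∞` data and `ν ≥ 0` is PROVED in the tree
(`Literature.Analysis.FluidPDE.exists_global_bkmClass_or_blowup`, Majda–Bertozzi 2002 Thm 3.6 with
Beale–Kato–Majda 1984); a `C_c^∞` datum is an `H^∞` datum. [cite: BealeKatoMajda1984, Thm. 1 and Corollary]
[cite: MajdaBertozzi2002, Thm. 3.6 and §3.3 (pp. 115–117)] -/
theorem step1_holds : Step1_BKM := by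
  intro ν hν u₀ hu₀
  obtain ⟨⟨hsm, hdiv, hH⟩, -⟩ := hu₀
  rcases exists_global_bkmClass_or_blowup hν.le hsm hdiv hH with
    ⟨u, p, hu, hu0, hB, -⟩ | ⟨T, hT, u, p, hu, hu0, hreg, -, -, hint, -⟩
  · exact Or.inl ⟨u, p, ⟨hu, hu0, hB⟩⟩
  · exact Or.inr ⟨T, hT, u, p, ⟨hu, hu0, hreg⟩, hint⟩

/-! ## Bookkeeping: restriction of a global solution of the class to `[0,T)` -/

/-- A global solution of the class restricts to a solution of the class on every `[0,T)`.
[folklore] -/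
private theorem isLocalSolution_of_global {ν : ℝ} (T : ℝ) {u₀ : E3 → E3} {u : ℝ → E3 → E3}
    {p : ℝ → E3 → ℝ} (h : Chae2007.IsGlobalSolution ν u₀ u p) :
    Chae2007.IsLocalSolution ν T u₀ u p :=
  ⟨h.isClassical.mono Ico_subset_Ici_self (uniqueDiffOn_Ico 0 T), h.initial,
    fun T'' _ => h.sobolev T''⟩

/-! ## Kernel composition (pure logic plus the two pieces of bookkeeping above) -/

/-- Along a solution of the class on `[0,T)`, Steps 4–5 bound `‖ω(t)‖_∞` by `max(X(0), X_max)` in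
`[0,∞]`. [cite: Santak2026, (7) p.3 and Thm 5.1 proof p.4 l.18–21] -/
theorem vortSup_le_of_steps (N : Substrate) (h4 : Step4_ODE7 N) {Xmax : ℝ}
    (h5 : ∀ (Y : ℝ → ℝ) (T : ℝ), ContinuousOn Y (Ico 0 T) →
      (∀ t ∈ Ioo 0 T, DifferentiableAt ℝ Y t ∧ deriv Y t ≤ rhs7 N (Y t)) →
        ∀ t ∈ Ico 0 T, Y t ≤ max (Y 0) Xmax)
    {ν T : ℝ} (hν : 0 < ν) {u₀ : E3 → E3} {u : ℝ → E3 → E3} {p : ℝ → E3 → ℝ} (hd : IsDatum u₀)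
    (hS : Chae2007.IsLocalSolution ν T u₀ u p) :
    ∀ t ∈ Ico 0 T, vortSup (u t) ≤ ENNReal.ofReal (max (X u 0) Xmax) := by
  obtain ⟨hfin, hcont, hdiff⟩ := h4 ν hν T u₀ u p hd hS
  intro t ht
  have hXt : X u t ≤ max (X u 0) Xmax := h5 (X u) T hcont hdiff t ht
  rw [← ENNReal.ofReal_toReal (hfin t ht).ne]
  exact ENNReal.ofReal_le_ofReal hXt

/-- **COMPOSITION** — Steps 1, 4, 5, 6 (with 2–3 the printed support of 4) imply the claimed statement,
for any choice of the printed objects `N`. [cite: Santak2026, §§1–5 pp.2–4] -/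
theorem claim_of_steps (N : Substrate) (h1 : Step1_BKM) (_h2 : Step2_Balance5 N)
    (_h3 : Step3_Lemma41 N) (h4 : Step4_ODE7 N) (h5 : Step5_Barrier N) (h6 : Step6_BKMIntegral) :
    ClaimedTheorem := by
  intro ν hν u₀ hd
  obtain ⟨Xmax, h5⟩ := h5
  rcases h1 ν hν u₀ hd with ⟨u, p, hG⟩ | ⟨Ts, hTs, u, p, hL, hint⟩
  · -- the global branch: (8) from Steps 4–5 on every `[0,T)`, then (9) from Step 6
    have h8 : (⨆ t ∈ Ici (0 : ℝ), vortSup (u t)) < ⊤ := by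
      refine lt_of_le_of_lt ?_ (ENNReal.ofReal_lt_top (r := max (X u 0) Xmax))
      refine iSup₂_le fun t ht => ?_
      have ht0 : (0 : ℝ) ≤ t := ht
      exact vortSup_le_of_steps N h4 h5 hν hd (isLocalSolution_of_global (t + 1) hG) t
        ⟨ht0, by linarith⟩
    exact ⟨u, p, hG, h8, h6 ν hν u₀ u p hd hG h8⟩
  · -- the blow-up branch is excluded: Steps 4–5 bound `‖ω‖_∞` on `[0,T*)`, so the BKM integral is finite
    exfalso
    have hle : (∫⁻ t in Ioo 0 Ts, vortSup (u t)) ≤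
        ∫⁻ _t in Ioo 0 Ts, ENNReal.ofReal (max (X u 0) Xmax) :=
      setLIntegral_mono' measurableSet_Ioo fun t ht =>
        vortSup_le_of_steps N h4 h5 hν hd hL t (Ioo_subset_Ico_self ht)
    have hlt : (∫⁻ t in Ioo 0 Ts, vortSup (u t)) < ⊤ := by
      refine lt_of_le_of_lt hle ?_
      rw [setLIntegral_const]
      exact ENNReal.mul_lt_top ENNReal.ofReal_lt_top measure_Ioo_lt_top
    exact absurd hint hlt.ne

/-! ## Discharge of Step 5 (rev 2, ns-claims-typist-4 g5, 2026-08-27; APPEND-ONLY — nothing above is touched).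
The barrier argument of Theorem 5.1's proof is elementary real analysis over the file's own `rhs7`. -/

namespace Barrier

variable (N : Substrate)

/-- `log(e + x) ≥ 1` for `x ≥ 0`. [folklore] -/
private theorem one_le_logE {x : ℝ} (hx : 0 ≤ x) : 1 ≤ Real.log (Real.exp 1 + x) := by
  have h := Real.log_le_log (Real.exp_pos 1) (le_add_of_nonneg_right hx : Real.exp 1 ≤ Real.exp 1 + x)
  rwa [Real.log_exp] at h

/-- `log(e + x)² ≤ 16 √2 √x` for `x ≥ e` (from `log y ≤ 4 y^{1/4}`). [folklore] -/
private theorem logE_sq_le {x : ℝ} (hx : Real.exp 1 ≤ x) :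
    Real.log (Real.exp 1 + x) ^ 2 ≤ 16 * Real.sqrt 2 * Real.sqrt x := by
  have he : 0 < Real.exp 1 := Real.exp_pos 1
  have hx0 : 0 ≤ x := le_trans he.le hx
  have hy : 0 ≤ Real.exp 1 + x := by linarith
  have hL0 : 0 ≤ Real.log (Real.exp 1 + x) := le_trans zero_le_one (one_le_logE hx0)
  have h1 : Real.log (Real.exp 1 + x) ≤ (Real.exp 1 + x) ^ (1 / 4 : ℝ) / (1 / 4 : ℝ) :=
    Real.log_le_rpow_div hy (by norm_num)
  have h2 : Real.log (Real.exp 1 + x) ≤ 4 * (Real.exp 1 + x) ^ (1 / 4 : ℝ) := by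
    have : (Real.exp 1 + x) ^ (1 / 4 : ℝ) / (1 / 4 : ℝ) = 4 * (Real.exp 1 + x) ^ (1 / 4 : ℝ) := by ring
    rw [this] at h1
    exact h1
  have h3 : Real.log (Real.exp 1 + x) ^ 2 ≤ (4 * (Real.exp 1 + x) ^ (1 / 4 : ℝ)) ^ 2 :=
    pow_le_pow_left₀ hL0 h2 2
  have h4 : (4 * (Real.exp 1 + x) ^ (1 / 4 : ℝ)) ^ 2 = 16 * Real.sqrt (Real.exp 1 + x) := by
    rw [mul_pow, ← Real.rpow_natCast ((Real.exp 1 + x) ^ (1 / 4 : ℝ)) 2, ← Real.rpow_mul hy,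
      Real.sqrt_eq_rpow]
    norm_num
  have h5 : Real.sqrt (Real.exp 1 + x) ≤ Real.sqrt 2 * Real.sqrt x := by
    rw [← Real.sqrt_mul (by norm_num : (0:ℝ) ≤ 2)]
    exact Real.sqrt_le_sqrt (by linarith)
  calc Real.log (Real.exp 1 + x) ^ 2 ≤ 16 * Real.sqrt (Real.exp 1 + x) := h3.trans_eq h4
    _ ≤ 16 * (Real.sqrt 2 * Real.sqrt x) := by gcongr
    _ = 16 * Real.sqrt 2 * Real.sqrt x := by ring

/-- The threshold `X_max` beyond which the right side of (7) is negative. [folklore] -/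
def xmax : ℝ :=
  max (Real.exp 1) ((16 * Real.sqrt 2 * |N.C| * (1 + 1 / N.Ψ₀) / N.c₀) ^ 2)

/-- Beyond `X_max`, `F(x) = Cx²(1 − log(e+x)/Ψ₀) − c₀x³/log(e+x) < 0`.
[cite: Santak2026, Thm 5.1 proof p.4 l.18–20] -/
theorem rhs7_neg {x : ℝ} (hx : xmax N < x) : rhs7 N x < 0 := by
  have he : 0 < Real.exp 1 := Real.exp_pos 1
  have hxe : Real.exp 1 ≤ x := le_of_lt (lt_of_le_of_lt (le_max_left _ _) hx)
  have hx0 : 0 < x := lt_of_lt_of_le he hxe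
  set A : ℝ := 16 * Real.sqrt 2 * |N.C| * (1 + 1 / N.Ψ₀) / N.c₀ with hA_def
  have hc₀ := N.c₀_pos
  have hΨ := N.Ψ₀_pos
  have hk : 0 < 1 + 1 / N.Ψ₀ := by positivity
  have hA0 : 0 ≤ A := by rw [hA_def]; positivity
  have hAx : A < Real.sqrt x := by
    have h2 : A ^ 2 < x := lt_of_le_of_lt (le_max_right _ _) hx
    calc A = Real.sqrt (A ^ 2) := (Real.sqrt_sq hA0).symm
      _ < Real.sqrt x := Real.sqrt_lt_sqrt (sq_nonneg A) h2
  set L : ℝ := Real.log (Real.exp 1 + x) with hL_def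
  have hL1 : 1 ≤ L := one_le_logE hx0.le
  have hL0 : 0 < L := lt_of_lt_of_le zero_lt_one hL1
  have hLsq : L ^ 2 ≤ 16 * Real.sqrt 2 * Real.sqrt x := logE_sq_le hxe
  -- `|C| k L² ≤ c₀ A √x < c₀ x`
  have hsx : 0 < Real.sqrt x := Real.sqrt_pos.mpr hx0
  have hkey : |N.C| * (1 + 1 / N.Ψ₀) * L ^ 2 < N.c₀ * x := by
    have h1 : |N.C| * (1 + 1 / N.Ψ₀) * L ^ 2 ≤ |N.C| * (1 + 1 / N.Ψ₀) * (16 * Real.sqrt 2 * Real.sqrt x) :=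
      mul_le_mul_of_nonneg_left hLsq (by positivity)
    have h2 : |N.C| * (1 + 1 / N.Ψ₀) * (16 * Real.sqrt 2 * Real.sqrt x) = N.c₀ * (A * Real.sqrt x) := by
      rw [hA_def]; field_simp
    have h3 : A * Real.sqrt x < x := by
      calc A * Real.sqrt x < Real.sqrt x * Real.sqrt x := mul_lt_mul_of_pos_right hAx hsx
        _ = x := Real.mul_self_sqrt hx0.le
    calc |N.C| * (1 + 1 / N.Ψ₀) * L ^ 2 ≤ N.c₀ * (A * Real.sqrt x) := h1.trans_eq h2
      _ < N.c₀ * x := mul_lt_mul_of_pos_left h3 hc₀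
  -- the stretching term is at most `|C| k x² L`
  have hstretch : N.C * x ^ 2 * (1 - L / N.Ψ₀) ≤ |N.C| * (1 + 1 / N.Ψ₀) * x ^ 2 * L := by
    have h1 : N.C * x ^ 2 * (1 - L / N.Ψ₀) ≤ |N.C| * x ^ 2 * (1 + L / N.Ψ₀) := by
      have ha : N.C * x ^ 2 * (1 - L / N.Ψ₀) ≤ |N.C * x ^ 2 * (1 - L / N.Ψ₀)| := le_abs_self _
      rw [abs_mul, abs_mul, abs_of_nonneg (sq_nonneg x)] at ha
      refine ha.trans (mul_le_mul_of_nonneg_left ?_ (by positivity))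
      have hLΨ : 0 ≤ L / N.Ψ₀ := div_nonneg hL0.le hΨ.le
      rw [abs_le]; constructor <;> linarith
    have h2 : 1 + L / N.Ψ₀ ≤ (1 + 1 / N.Ψ₀) * L := by
      have : (1 + 1 / N.Ψ₀) * L = L + L / N.Ψ₀ := by ring
      rw [this]; linarith
    calc N.C * x ^ 2 * (1 - L / N.Ψ₀) ≤ |N.C| * x ^ 2 * (1 + L / N.Ψ₀) := h1
      _ ≤ |N.C| * x ^ 2 * ((1 + 1 / N.Ψ₀) * L) := mul_le_mul_of_nonneg_left h2 (by positivity)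
      _ = |N.C| * (1 + 1 / N.Ψ₀) * x ^ 2 * L := by ring
  -- compare with the cubic term
  have hcubic : |N.C| * (1 + 1 / N.Ψ₀) * x ^ 2 * L < N.c₀ * x ^ 3 / L := by
    rw [lt_div_iff₀ hL0]
    have : |N.C| * (1 + 1 / N.Ψ₀) * x ^ 2 * L * L = (|N.C| * (1 + 1 / N.Ψ₀) * L ^ 2) * x ^ 2 := by ring
    rw [this]
    have : N.c₀ * x ^ 3 = (N.c₀ * x) * x ^ 2 := by ring
    rw [this]
    exact mul_lt_mul_of_pos_right hkey (pow_pos hx0 2)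
  show N.C * x ^ 2 * (1 - Real.log (Real.exp 1 + x) / N.Ψ₀) -
      N.c₀ * x ^ 3 / Real.log (Real.exp 1 + x) < 0
  rw [← hL_def]
  linarith

/-- **The barrier argument of Theorem 5.1's proof** (p.4 l.18–21): a continuous `Y` on `[0,T)`,
differentiable on `(0,T)` with `Y′ ≤ F(Y)`, never exceeds `max(Y(0), X_max)` — on any excursion above
that level `Y′ < 0` (mean value theorem), so the excursion cannot start.
[cite: Santak2026, Thm 5.1 proof p.4 l.18–21] -/
theorem le_max_of_deriv_le {Y : ℝ → ℝ} {T : ℝ} (hc : ContinuousOn Y (Ico 0 T))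
    (hd : ∀ t ∈ Ioo 0 T, DifferentiableAt ℝ Y t ∧ deriv Y t ≤ rhs7 N (Y t)) :
    ∀ t ∈ Ico 0 T, Y t ≤ max (Y 0) (xmax N) := by
  intro t ht
  set M := max (Y 0) (xmax N) with hM_def
  by_contra hcon
  push Not at hcon
  have ht0 : 0 < t := by
    rcases ht.1.eq_or_lt with h | h
    · exact absurd (h ▸ le_max_left _ _ : Y t ≤ M) (not_le.mpr hcon)
    · exact h
  -- the last time in `[0,t]` at which `Y ≤ M`
  set S : Set ℝ := Icc 0 t ∩ Y ⁻¹' Iic M with hS_def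
  have hcont' : ContinuousOn Y (Icc 0 t) := hc.mono fun s hs => ⟨hs.1, lt_of_le_of_lt hs.2 ht.2⟩
  have hSclosed : IsClosed S := hcont'.preimage_isClosed_of_isClosed isClosed_Icc isClosed_Iic
  have hSne : S.Nonempty := ⟨0, ⟨le_rfl, ht.1⟩, (le_max_left _ _ : Y 0 ≤ M)⟩
  have hSbdd : BddAbove S := bddAbove_Icc.mono inter_subset_left
  set s := sSup S with hs_def
  have hsS : s ∈ S := hSclosed.csSup_mem hSne hSbdd
  have hs0 : 0 ≤ s := hsS.1.1
  have hst : s ≤ t := hsS.1.2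
  have hYs : Y s ≤ M := hsS.2
  have hslt : s < t := lt_of_le_of_ne hst fun h => (not_le.mpr hcon) (h ▸ hYs)
  -- above `M` on `(s, t]`
  have habove : ∀ c ∈ Ioc s t, M < Y c := by
    intro c hc
    by_contra hle
    push Not at hle
    have hcS : c ∈ S := ⟨⟨le_trans hs0 hc.1.le, hc.2⟩, hle⟩
    exact absurd (le_csSup hSbdd hcS) (not_le.mpr hc.1)
  -- mean value theorem on `[s, t]`
  have hcst : ContinuousOn Y (Icc s t) := hcont'.mono fun c hc => ⟨le_trans hs0 hc.1, hc.2⟩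
  have hdst : DifferentiableOn ℝ Y (Ioo s t) := fun c hc =>
    (hd c ⟨lt_of_le_of_lt hs0 hc.1, lt_trans hc.2 ht.2⟩).1.differentiableWithinAt
  obtain ⟨c, hc, hcd⟩ := exists_deriv_eq_slope Y hslt hcst hdst
  have hYc : xmax N < Y c :=
    lt_of_le_of_lt (le_max_right _ _) (habove c ⟨hc.1, hc.2.le⟩)
  have hneg : deriv Y c < 0 :=
    lt_of_le_of_lt (hd c ⟨lt_of_le_of_lt hs0 hc.1, lt_trans hc.2 ht.2⟩).2 (rhs7_neg N hYc)
  rw [hcd] at hneg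
  have hnum : Y t - Y s < 0 := by
    have := (div_neg_iff.mp hneg)
    rcases this with ⟨_, h⟩ | ⟨h, _⟩
    · linarith
    · linarith
  linarith [habove t ⟨hslt, le_rfl⟩]

end Barrier

/-- **Step 5 holds** — the barrier argument of Theorem 5.1's proof (p.4 l.18–21: «dX/dt ≤ 0 for all
X ≥ X_max. Boundedness of X(t) follows immediately via standard differential inequality arguments») is
kernel-true at the grain typed: with `X_max = max(e, (16√2·|C|(1+1/Ψ₀)/c₀)²)` the right side of (7) is
negative beyond `X_max` (`log(e+x)² ≤ 16√2·√x` for `x ≥ e`), and a continuous `Y` with `Y′ ≤ F(Y)` inside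
cannot climb above `max(Y(0), X_max)` (last time below the level + mean value theorem). Nothing else in
the file changes. [cite: Santak2026, Thm 5.1 proof p.4 l.18–21] -/
theorem step5_holds (N : Substrate) : Step5_Barrier N :=
  ⟨Barrier.xmax N, fun _Y _T hc hd => Barrier.le_max_of_deriv_le N hc hd⟩

/-- `Step5_Barrier` holds for all parameters — `_holds` alias of `step5_holds` above under the fact's exact name
(appended 2026-08-28, D-0026 bookkeeping: the proof term is the existing theorem of this file; no statement,
definition or attribute is edited; no new named fact; the ledger's debt table listed the fact
unproved). [cite: Santak2026, Thm 5.1 proof p.4 l.18–21] -/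
theorem _root_.Literature.Claims.NS.Santak2026.Step5_Barrier_holds (N : Substrate) :
    Step5_Barrier N :=
  _root_.Literature.Claims.NS.Santak2026.step5_holds N

/-! ## The Clay link on the printed data class (rev 2; Δ4 stays recorded) -/

/-- **Clay link on the printed data class (Δ4 recorded, not removed)**: the claimed theorem yields
Clay-solvability `clayR3.Solvable ν 0 u₀` ((A)'s conclusion: smooth `(u,p)` on `ℝ³ × [0,∞)` solving
(1)–(3) with bounded energy (7)) for every `ν > 0` and every datum OF THE PRINTED CLASS (smooth,
divergence free, compactly supported) — NOT for all of Clay's class (4), which is wider; hence no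
`clay_of_claimed`. Bridge as in C17 `Chae2007.clay_of_claimedNS`: the BKM-class global solution is smooth
on the closed half-space with `u(0) = u₀` (`isNavierStokesSolution_and_smooth_iff`) and its energy is
bounded by `∫|u₀|²` (`IsClassicalNSSolutionOn.bkm_energy_le`, Majda–Bertozzi Prop. 3.1).
[cite: FeffermanClay2006, statement (A) with (4) (6) (7), CMI offprint p. 2] -/
theorem claySolvable_of_claimed (h : ClaimedTheorem) {ν : ℝ} (hν : 0 < ν) {u₀ : E3 → E3}
    (hd : IsDatum u₀) : ClayVariants.clayR3.Solvable ν 0 u₀ := by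
  obtain ⟨u, p, hsol, -, -⟩ := h ν hν u₀ hd
  obtain ⟨hns, hsu, hsp⟩ :=
    (isNavierStokesSolution_and_smooth_iff (ν := ν) (f := 0) (u₀ := u₀) (u := u) (p := p)).2
      ⟨hsol.isClassical, hsol.initial⟩
  refine ⟨u, p, hsu, hsp, hns, ?_⟩
  show HasBoundedEnergy u
  have key : ∀ S : ℝ, 0 < S → ∀ τ ∈ Icc (0:ℝ) S,
      ∫⁻ x, ‖u τ x‖ₑ ^ 2 = ENNReal.ofReal (∫ x, ‖u τ x‖ ^ 2) := by
    intro S hS τ hτ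
    have hcl : IsClassicalNSSolutionOn (Icc 0 S) ν 0 u p :=
      hsol.isClassical.mono Icc_subset_Ici_self (uniqueDiffOn_Icc hS)
    obtain ⟨C, hC⟩ := hsol.sobolev S 0
    have hfin0 : ∫⁻ x, ‖iteratedFDeriv ℝ 0 (u τ) x‖ₑ ^ 2 < ⊤ := (hC τ hτ).trans_lt ENNReal.coe_lt_top
    have heq : (fun x => ‖iteratedFDeriv ℝ 0 (u τ) x‖ₑ ^ 2) = fun x => ‖u τ x‖ₑ ^ 2 := by
      funext x
      rw [← ofReal_norm, norm_iteratedFDeriv_zero, ofReal_norm]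
    have hfin : ∫⁻ x, ‖u τ x‖ₑ ^ 2 < ⊤ := by rwa [heq] at hfin0
    have hint : Integrable (fun x => ‖u τ x‖ ^ 2) :=
      integrable_sq_norm_of_lintegral_lt_top (hcl.contDiff_velocity hτ).continuous hfin
    rw [ofReal_integral_eq_lintegral_ofReal hint (Eventually.of_forall fun x => sq_nonneg _)]
    refine lintegral_congr fun x => ?_
    rw [← ofReal_norm, ENNReal.ofReal_pow (norm_nonneg _)]
  refine ⟨∫⁻ x, ‖u₀ x‖ₑ ^ 2, ?_, fun t ht => ?_⟩
  · have h0 := hd.1.2.2 0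
    have heq : (fun x => ‖iteratedFDeriv ℝ 0 u₀ x‖ₑ ^ 2) = fun x => ‖u₀ x‖ₑ ^ 2 := by
      funext x
      rw [← ofReal_norm, norm_iteratedFDeriv_zero, ofReal_norm]
    rwa [heq] at h0
  · have hT : (0:ℝ) < t + 1 := by linarith
    have hcl : IsClassicalNSSolutionOn (Icc 0 (t + 1)) ν 0 u p :=
      hsol.isClassical.mono Icc_subset_Ici_self (uniqueDiffOn_Icc hT)
    have hE : ∫ x, ‖u t x‖ ^ 2 ≤ ∫ x, ‖u 0 x‖ ^ 2 :=
      hcl.bkm_energy_le hν.le hT (hsol.sobolev (t + 1)) ⟨ht, by linarith⟩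
    rw [key (t + 1) hT t ⟨ht, by linarith⟩, ← hsol.initial, key (t + 1) hT 0 ⟨le_rfl, hT.le⟩]
    exact ENNReal.ofReal_le_ofReal hE

end

end Literature.Claims.NS.Santak2026

-- WHAT THIS IS NOT: not a claim about NS regularity or blow-up; not a claim about any author beyond
-- the typed locator.
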